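import Mathlib
import Summits.Ventures.PercRepro2.HCov
import Summits.Ventures.PercRepro2.BHKAvoid
import Summits.Ventures.PercRepro2.ExploreA3
import Summits.Ventures.PercRepro2.RootLeafUSigns
import Summits.Ventures.PercRepro2.RootLeafUCore

/-!
# (G4-u) on the separating class, part 1: the `c`-side is independent of the cluster of `u`
(blind cell PercRepro2, p4 g8; S3 (G4-u), proofs/P4-G8-SEP.md)

Setting of `RootLeafUTheorem` / `RootLeafUHalf`: the two-root instance on `G₁ = G − a₁` (roots
`u, a₂`; `L = C(u)`, `K = C(a₂)`, `Q = {u ↮ a₂}`; marks `o, c, b`).  The separating class is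

  **`∀ ω, Conn ω u c → Conn ω u a₂`**  (every open `u–c` connection passes through `a₂`).

* Graph part (`Sep.conn_delConfig_iff`): deleting a cluster of `u` that avoids `a₂` never changes
  the event `a₂ ↔ c` — by the closure lemma `mem_of_conn_of_closed`, with `H = C(u)` in `G − a₂`
  (no paths).
* Independence (`Sep.prob_Q_clusterIn_conn_eq`): for every family `𝓤` of vertex sets,
  `P(Q, C(u) ∈ 𝓤, a₂ ↔ c) = P(a₂ ↔ c) · P(Q, C(u) ∈ 𝓤)` (explore `C(u)` with
  `prob_clusterIn_inter_avoid_eq_expect`; the residual connection probability of `c` is the global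
  one), hence `P(PD, X) = d0 · P(Q, X)` and `P(T, X) = P(a₂ ↔ c) · P(Q, X)` for every `L`-event `X`
  (`Sep.prob_PD_clusterIn_eq`, `Sep.prob_T_clusterIn_eq`), and `T′ = ∅` (`Sep.TEvent_swap_eq_empty`).

Part 2 (`RootLeafUSep`) derives `0 ≤ T2oL`, `0 ≤ T2oK` and the class theorem
`HCov_root_leaf_u_of_sep` from these.
-/

namespace Summit.Ventures.PercRepro2

open UnionCluster CovForm

namespace RootLeafU

namespace Sep

/-! ## Graph part: deleting a `u`-cluster avoiding `a₂` does not change `a₂ ↔ c` -/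

section SepGraph

variable {V : Type*} {E : Type*} {ends : E → Sym2 V}

/-- Every configuration is below the all-open one `fun _ => true`. -/
lemma le_topCfg (ω : Config E) : ω ≤ (fun _ => true : Config E) := fun _ => Bool.le_true _

/-- `delConfig` is monotone in the configuration. -/
lemma delConfig_mono (W : Set V) {ω ω' : Config E} (h : ω ≤ ω') :
    delConfig ends W ω ≤ delConfig ends W ω' := by
  intro e
  by_cases he : e ∈ touches ends W
  · rw [delConfig_apply_of_mem he, delConfig_apply_of_mem he]
  · rw [delConfig_apply_of_notMem he, delConfig_apply_of_notMem he]
    exact h e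

/-- An edge touches `{a}` iff `a` is one of its endpoints. -/
lemma mem_touches_singleton_iff {a : V} {e : E} : e ∈ touches ends {a} ↔ a ∈ ends e := by
  constructor
  · rintro ⟨x, hx, y, hxy⟩
    rw [Set.mem_singleton_iff] at hx
    subst hx
    rw [hxy]
    exact Sym2.mem_mk_left _ _
  · intro h
    obtain ⟨y, hy⟩ := Sym2.mem_iff_exists.1 h
    exact ⟨a, rfl, y, hy⟩

/-- In `delConfig ends {a} ω` every edge at `a` is closed. -/
lemma delConfig_singleton_closed (a : V) (ω : Config E) {e : E} (h : a ∈ ends e) :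
    delConfig ends {a} ω e = false :=
  delConfig_apply_of_mem (mem_touches_singleton_iff.2 h)

/-- If every edge at `a` is closed, nothing but `a` is connected to `a`. -/
lemma eq_of_conn_of_isolated {ω : Config E} {a : V} (hiso : ∀ e, a ∈ ends e → ω e = false)
    {x : V} (h : Conn ends ω x a) : x = a := by
  by_contra hxa
  have key : a ∈ {v | v ≠ a} := by
    refine mem_of_conn_of_closed (ends := ends) (ω := ω) ?_ hxa h
    intro v hv y hvy
    obtain ⟨_, e, he, hends⟩ := openGraph_adj.1 hvy
    intro hya
    subst hya
    have := hiso e (by rw [hends]; exact Sym2.mem_mk_right _ _)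
    rw [he] at this
    exact Bool.true_eq_false.mp this
  exact key rfl

/-- `a` is isolated in `delConfig ends {a} ω`: only `a` is connected to `a`. -/
lemma eq_of_conn_delConfig_singleton {ω : Config E} {a x : V}
    (h : Conn ends (delConfig ends {a} ω) x a) : x = a :=
  eq_of_conn_of_isolated (fun _ he => delConfig_singleton_closed a ω he) h

/-- The cluster of `u` in `G − a` is closed under adjacency along edges not at `a`. -/
lemma mem_delCluster_of_adj {a u x y : V} (hx : x ∈ cluster ends (delConfig ends {a} (fun _ => true : Config E)) u)
    {e : E} (hae : a ∉ ends e) (hxy : ends e = s(x, y)) :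
    y ∈ cluster ends (delConfig ends {a} (fun _ => true : Config E)) u := by
  have hopen : delConfig ends {a} (fun _ => true : Config E) e = true := by
    rw [delConfig_apply_of_notMem (fun h => hae (mem_touches_singleton_iff.1 h))]
  exact conn_trans hx (conn_of_openAdj ⟨e, hopen, hxy⟩)

/-- A cluster of `u` avoiding `a` lies inside the cluster of `u` in `G − a`. -/
lemma cluster_subset_delCluster {ω₀ : Config E} {a u : V} (h₀ : ¬ Conn ends ω₀ u a) :
    cluster ends ω₀ u ⊆ cluster ends (delConfig ends {a} (fun _ => true : Config E)) u := by
  intro w hw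
  have hsub : cluster ends (delConfig ends {a} ω₀) u ⊆
      cluster ends (delConfig ends {a} (fun _ => true : Config E)) u :=
    cluster_mono (delConfig_mono {a} (le_topCfg ω₀)) u
  refine hsub ?_
  refine mem_of_conn_of_closed (ends := ends) (ω := ω₀) ?_ (mem_cluster_self ends _ u) hw
  intro x hx y hxy
  obtain ⟨_, e, he, hends⟩ := openGraph_adj.1 hxy
  have hxω : x ∈ cluster ends ω₀ u := cluster_mono (delConfig_le ends {a} ω₀) u hx
  by_cases hae : a ∈ ends e
  · exfalso
    rw [hends, Sym2.mem_iff] at hae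
    rcases hae with rfl | rfl
    · exact h₀ hxω
    · exact h₀ (conn_trans hxω (conn_of_openAdj ⟨e, he, hends⟩))
  · have hopen : delConfig ends {a} ω₀ e = true := by
      rw [delConfig_apply_of_notMem (fun h => hae (mem_touches_singleton_iff.1 h))]
      exact he
    exact conn_trans hx (conn_of_openAdj ⟨e, hopen, hends⟩)

/-- **Deleting a `u`-cluster that avoids `a₂` does not change `a₂ ↔ c`** when `a₂` separates `u`
from `c` (`∀ ω, Conn ω u c → Conn ω u a₂`). -/
theorem conn_delConfig_iff {u a₂ c : V} (hsep : ∀ ω : Config E, Conn ends ω u c → Conn ends ω u a₂)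
    (hua : u ≠ a₂) {ω₀ : Config E} (h₀ : ¬ Conn ends ω₀ u a₂) (ω : Config E) :
    Conn ends (delConfig ends (cluster ends ω₀ u) ω) a₂ c ↔ Conn ends ω a₂ c := by
  constructor
  · exact conn_mono (delConfig_le ends _ ω)
  · intro h
    set H := cluster ends (delConfig ends {a₂} (fun _ => true : Config E)) u with hH
    have hcH : c ∉ H := fun hc => hua (eq_of_conn_delConfig_singleton (hsep _ hc))
    have haH : a₂ ∉ H := fun ha => hua (eq_of_conn_delConfig_singleton ha)
    set W := cluster ends ω₀ u with hW
    have hWH : W ⊆ H := cluster_subset_delCluster h₀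
    have key : c ∈ cluster ends (delConfig ends W ω) a₂ ∪ H := by
      refine mem_of_conn_of_closed (ends := ends) (ω := ω) ?_
        (Or.inl (mem_cluster_self ends _ a₂)) h
      intro x hx y hxy
      obtain ⟨hne, e, he, hends⟩ := openGraph_adj.1 hxy
      by_cases hxH : x ∈ H
      · by_cases hya : y = a₂
        · subst hya
          exact Or.inl (mem_cluster_self ends _ _)
        · have hxa : x ≠ a₂ := fun hx' => haH (hx' ▸ hxH)
          have hae : a₂ ∉ ends e := by
            rw [hends, Sym2.mem_iff]
            rintro (h' | h')
            · exact hxa h'.symm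
            · exact hya h'.symm
          exact Or.inr (mem_delCluster_of_adj hxH hae hends)
      · have hx' : x ∈ cluster ends (delConfig ends W ω) a₂ := hx.resolve_right hxH
        by_cases heW : e ∈ touches ends W
        · obtain ⟨z, hzW, y', hz⟩ := heW
          have hz' : z ∈ ends e := by rw [hz]; exact Sym2.mem_mk_left _ _
          rw [hends, Sym2.mem_iff] at hz'
          rcases hz' with rfl | rfl
          · exact absurd (hWH hzW) hxH
          · exact Or.inr (hWH hzW)
        · have hopen : delConfig ends W ω e = true := by
            rw [delConfig_apply_of_notMem heW]
            exact he
          exact Or.inl (mem_cluster_of_adj hx' (openGraph_adj.2 ⟨hne, e, hopen, hends⟩))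
    exact key.resolve_right hcH

end SepGraph

/-! ## Independence of the `c`-side under `Q` -/

section SepProb

variable {V : Type*} {E : Type*} [Fintype E] [DecidableEq E] [Fintype V] [DecidableEq V]
  {R : Type*} [Field R] [LinearOrder R] [IsStrictOrderedRing R]

variable (p : E → R) (ends : E → Sym2 V) (o a₂ c b u : V)

omit [Fintype E] [DecidableEq E] [Fintype V] [DecidableEq V] in
/-- `{u ↮ {a₂}} = Q = {a₂ ↮ {u}}`. -/
lemma avoidAll_singleton_comm : avoidAll ends u {a₂} = avoidAll ends a₂ {u} := by
  rw [avoidAll_singleton_eq ends, avoidAll_singleton_eq ends, connEvent_comm ends]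

omit [Fintype E] [DecidableEq E] [Fintype V] [DecidableEq V] in
/-- On the separating class `T′ = {u ↮ a₂, u ↔ c}` is empty: `c ∉ L` on `Q`. -/
lemma TEvent_swap_eq_empty (hsep : ∀ ω : Config E, Conn ends ω u c → Conn ends ω u a₂) :
    TEvent ends a₂ u c = ∅ := by
  ext ω
  simp only [TEvent, Set.mem_inter_iff, Set.mem_compl_iff, mem_connEvent, Set.mem_empty_iff_false,
    iff_false, not_and]
  exact fun h1 h2 => h1 (hsep ω h2)

omit [Fintype E] [DecidableEq E] [Fintype V] [DecidableEq V] in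
/-- On the separating class `PD = Q ∩ {a₂ ↮ c}`. -/
lemma PDEvent_eq (hsep : ∀ ω : Config E, Conn ends ω u c → Conn ends ω u a₂) :
    PDEvent ends u a₂ c = avoidAll ends a₂ {u} ∩ (connEvent ends a₂ c)ᶜ := by
  rw [avoidAll_singleton_eq ends]
  ext ω
  simp only [PDEvent, Dtilde, inU, Set.mem_inter_iff, Set.mem_compl_iff, Set.mem_union,
    mem_connEvent, not_or]
  constructor
  · rintro ⟨h1, _, h3⟩
    exact ⟨fun h => h1 (conn_symm h), fun h => h3 (conn_symm h)⟩
  · rintro ⟨h1, h2⟩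
    exact ⟨fun h => h1 (conn_symm h), fun h => h1 (conn_symm (hsep ω (conn_symm h))),
      fun h => h2 (conn_symm h)⟩

omit [Fintype E] [DecidableEq E] [Fintype V] [DecidableEq V] in
/-- `T = Q ∩ {a₂ ↔ c}`. -/
lemma TEvent_eq : TEvent ends u a₂ c = avoidAll ends a₂ {u} ∩ connEvent ends a₂ c := by
  rw [avoidAll_singleton_eq ends]
  rfl

omit [DecidableEq V] [LinearOrder R] [IsStrictOrderedRing R] in
/-- **Independence of `a₂ ↔ c` from the cluster of `u` under `Q`** on the separating class: for
every family `𝓤` of vertex sets, `P(Q, C(u) ∈ 𝓤, a₂ ↔ c) = P(a₂ ↔ c) · P(Q, C(u) ∈ 𝓤)`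
(explore `C(u)`; by `conn_delConfig_iff` the residual probability of `a₂ ↔ c` is the global one). -/
theorem prob_Q_clusterIn_conn_eq (hsep : ∀ ω : Config E, Conn ends ω u c → Conn ends ω u a₂)
    (hua : u ≠ a₂) (𝓤 : Set (Set V)) :
    prob p (avoidAll ends a₂ {u} ∩ clusterInEvent ends u 𝓤 ∩ connEvent ends a₂ c) =
      prob p (connEvent ends a₂ c) * prob p (avoidAll ends a₂ {u} ∩ clusterInEvent ends u 𝓤) := by
  classical
  have ha2 : a₂ ∈ ({a₂} : Finset V) := by simp
  have tB := prob_clusterIn_inter_avoid_eq_expect p ends u a₂ ha2 𝓤 {W | c ∈ W}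
  have t1 := prob_clusterIn_inter_avoid_eq_expect p ends u a₂ ha2 𝓤 Set.univ
  have hg1 : ∀ K, delClusterProb p ends a₂ Set.univ K = 1 := delClusterProb_univ p ends a₂
  simp only [clusterInEvent_univ, Set.inter_univ, hg1, mul_one] at t1
  rw [ExploreA3.clusterInEvent_mem_eq] at tB
  have e1 : clusterInEvent ends u 𝓤 ∩ connEvent ends a₂ c ∩ avoidAll ends u {a₂} =
      avoidAll ends a₂ {u} ∩ clusterInEvent ends u 𝓤 ∩ connEvent ends a₂ c := by
    rw [avoidAll_singleton_comm ends a₂ u]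
    ext ω
    simp only [Set.mem_inter_iff]
    tauto
  have e2 : clusterInEvent ends u 𝓤 ∩ avoidAll ends u {a₂} =
      avoidAll ends a₂ {u} ∩ clusterInEvent ends u 𝓤 := by
    rw [avoidAll_singleton_comm ends a₂ u, Set.inter_comm]
  rw [e1] at tB
  rw [e2] at t1
  rw [tB, t1, ← expect_const_mul]
  congr 1
  funext ω
  by_cases hω : ω ∈ avoidAll ends u {a₂}
  · have h₀ : ¬ Conn ends ω u a₂ := hω a₂ (Finset.mem_singleton_self a₂)
    have hg : delClusterProb p ends a₂ {W | c ∈ W} (cluster ends ω u) =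
        prob p (connEvent ends a₂ c) := by
      unfold delClusterProb
      congr 1
      ext ω'
      simp only [Set.mem_setOf_eq, mem_cluster, mem_connEvent]
      exact conn_delConfig_iff hsep hua h₀ ω'
    rw [hg]
    ring
  · simp only [Set.indicator_of_notMem hω, mul_zero]

omit [DecidableEq V] in
/-- The complementary form: `P(Q, C(u) ∈ 𝓤, a₂ ↮ c) = d0 · P(Q, C(u) ∈ 𝓤)`. -/
theorem prob_Q_clusterIn_notConn_eq (hsep : ∀ ω : Config E, Conn ends ω u c → Conn ends ω u a₂)
    (hua : u ≠ a₂) (𝓤 : Set (Set V)) :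
    prob p (avoidAll ends a₂ {u} ∩ clusterInEvent ends u 𝓤 ∩ (connEvent ends a₂ c)ᶜ) =
      prob p (avoidAll ends a₂ {c}) * prob p (avoidAll ends a₂ {u} ∩ clusterInEvent ends u 𝓤) := by
  have h := prob_inter_add_prob_inter_compl p (avoidAll ends a₂ {u} ∩ clusterInEvent ends u 𝓤)
    (connEvent ends a₂ c)
  rw [prob_Q_clusterIn_conn_eq p ends a₂ c u hsep hua 𝓤] at h
  rw [avoidAll_singleton_eq ends a₂ c, prob_compl]
  linear_combination h

omit [DecidableEq V] in
/-- `P(PD, C(u) ∈ 𝓤) = d0 · P(Q, C(u) ∈ 𝓤)` on the separating class. -/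
theorem prob_PD_clusterIn_eq (hsep : ∀ ω : Config E, Conn ends ω u c → Conn ends ω u a₂)
    (hua : u ≠ a₂) (𝓤 : Set (Set V)) :
    prob p (PDEvent ends u a₂ c ∩ clusterInEvent ends u 𝓤) =
      prob p (avoidAll ends a₂ {c}) * prob p (avoidAll ends a₂ {u} ∩ clusterInEvent ends u 𝓤) := by
  rw [PDEvent_eq ends a₂ c u hsep, ← prob_Q_clusterIn_notConn_eq p ends a₂ c u hsep hua 𝓤]
  congr 1
  ext ω
  simp only [Set.mem_inter_iff]
  tauto

omit [DecidableEq V] [LinearOrder R] [IsStrictOrderedRing R] in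
/-- `P(T, C(u) ∈ 𝓤) = P(a₂ ↔ c) · P(Q, C(u) ∈ 𝓤)` on the separating class. -/
theorem prob_T_clusterIn_eq (hsep : ∀ ω : Config E, Conn ends ω u c → Conn ends ω u a₂)
    (hua : u ≠ a₂) (𝓤 : Set (Set V)) :
    prob p (TEvent ends u a₂ c ∩ clusterInEvent ends u 𝓤) =
      prob p (connEvent ends a₂ c) * prob p (avoidAll ends a₂ {u} ∩ clusterInEvent ends u 𝓤) := by
  rw [TEvent_eq ends a₂ c u, ← prob_Q_clusterIn_conn_eq p ends a₂ c u hsep hua 𝓤]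
  congr 1
  ext ω
  simp only [Set.mem_inter_iff]
  tauto

end SepProb

end Sep

end RootLeafU

end Summit.Ventures.PercRepro2
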